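import Mathlib.LinearAlgebra.Countable
import Literature.AlgebraicGeometry.HodgeTheory.HodgeFiltration
import Literature.AlgebraicTopology.SingularHomology.CohomologyRingChange
import Literature.AlgebraicGeometry.Motives.BettiCycleClassFiniteProofs
import HarnessLib

/-!
# Integral classes are the image of `Hᵏ(Y; ℤ) → Hᵏ(Y; ℂ)`; on `X(ℂ)` they form a countable set

Family `hodge`, layer `Literature/AlgebraicGeometry/HodgeTheory`. Companion to `HodgeFiltration`
(`IsIntegralClass c`: the class `c ∈ Hᵏ(Y; ℂ)` is represented by a `ℤ`-valued cocycle) and to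
`Literature/AlgebraicTopology/SingularHomology/CohomologyRingChange` (the change of coefficient
ring `f_* : Hᵏ(Y; R) → Hᵏ(Y; S)`, `[u] ↦ [f ∘ u]`, Hatcher §3.1 p. 198). PROVED here:

* `isIntegralClass_iff_mem_range_ringChange`: `c` is integral iff it lies in the image of
  `Hᵏ(Y; ℤ) → Hᵏ(Y; ℂ)` (the docstring of `IsIntegralClass`: "a `ℤ`-valued `ℂ`-cocycle is the
  image of a `ℤ`-cocycle, the coboundary commuting with `ℤ ↪ ℂ`"; Voisin I, §7.1.1 "the integral
  structure"; Hatcher §3.1 p. 198);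
* `countable_setOf_isIntegralClass`: if `Hᵏ(Y; ℤ)` is finitely generated, the integral classes
  of `Hᵏ(Y; ℂ)` form a COUNTABLE set (a finitely generated abelian group is countable);
* `countable_setOf_isIntegralClass_complexPoints`: so for `X` smooth projective over `ℂ`, by the
  theorem `Motives.bettiCohomologyInt_finite_holds` (`Hᵏ(X(ℂ); ℤ)` is finitely generated:
  `X(ℂ)` is a compact manifold, Hatcher App. A Cor. A.8–A.9 and §3.1 Cor. 3.3).

Consumer: the Baire-category step of Noether–Lefschetz-type arguments ("when `X` lies outside
the countable union of the `U_λ^{k-1}` for integral `λ`", Voisin II, proof of Lemma 8.18; the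
hypothesis `hL : L.Countable` of `exists_forall_isIntegralClass_imp_eq_zero_of_family`, file
`HodgeLociInfinitesimal`), for the barrier fact
`Literature.Barriers.HodgeConjecture.Voisin2003_generalHypersurface_noIntegralClassInF`.

## References

* A. Hatcher, *Algebraic Topology* (2002), §3.1 p. 198 (change of coefficients), App. A
  Cor. A.8–A.9. [HatcherAT2002]
* C. Voisin, *Hodge Theory and Complex Algebraic Geometry I* (2002), §7.1.1. [VoisinHodgeI2002]
* C. Voisin, *Hodge Theory and Complex Algebraic Geometry II* (2003), Lemma 8.18 (proof).
  [VoisinHodgeII2003]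
-/

noncomputable section

open CategoryTheory

universe u

namespace Literature.AlgebraicGeometry.HodgeTheory

section HodgeTheory

open Literature.AlgebraicTopology.SingularHomology singularCochainComplex

/-- **Integral classes are the image of `Hᵏ(Y; ℤ) → Hᵏ(Y; ℂ)`.** A class of `Hᵏ(Y; ℂ)` is
represented by a `ℤ`-valued cocycle iff it is the image of a class of `Hᵏ(Y; ℤ)` under the
change of coefficients along `ℤ ↪ ℂ` (`singularCohomology.ringChange (Int.castRingHom ℂ)`): a
`ℤ`-valued `ℂ`-cocycle is `ι ∘ φ` for an integer cochain `φ`, which is a cocycle because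
`ι ∘ δφ = δ(ι ∘ φ) = 0` and `ι : ℤ → ℂ` is injective. [cite: HatcherAT2002, §3.1 p. 198]
[cite: VoisinHodgeI2002, §7.1.1] -/
theorem isIntegralClass_iff_mem_range_ringChange {Y : Type u} [TopologicalSpace Y] {k : ℕ}
    (c : singularCohomology ℂ ℂ Y k) :
    IsIntegralClass c ↔ c ∈ Set.range (singularCohomology.ringChange (Int.castRingHom ℂ) Y k) := by
  constructor
  · rintro ⟨z, rfl, hz⟩
    choose φ hφ using hz
    have hcomp : (Int.castRingHom ℂ) ∘ φ = coFn z := funext fun σ ↦ hφ σ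
    have hd : (singularCochainComplex ℤ ℤ Y).d k (k + 1) φ = 0 := by
      change coboundary k φ = 0
      have h1 : (Int.castRingHom ℂ) ∘ coboundary k φ = 0 := by
        rw [← coboundary_comp_ringHom, hcomp, coboundary_coFn]
      funext σ
      have h2 := congr_fun h1 σ
      simp only [Function.comp_apply, Pi.zero_apply, eq_intCast, Int.cast_eq_zero] at h2
      exact h2
    refine ⟨singularCohomology.π ℤ ℤ Y k (cocyclesMk φ hd), ?_⟩
    rw [singularCohomology.ringChange_π]
    congr 1
    exact coFn_injective (by rw [coFn_cocyclesRingChange, coFn_cocyclesMk, hcomp])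
  · rintro ⟨x, rfl⟩
    obtain ⟨u, rfl⟩ := π_surjective ℤ k x
    refine ⟨cocyclesRingChange (Int.castRingHom ℂ) k u,
      (singularCohomology.ringChange_π _ u).symm, fun σ ↦ ⟨coFn u σ, ?_⟩⟩
    change _ = coFn (cocyclesRingChange (Int.castRingHom ℂ) k u) σ
    rw [coFn_cocyclesRingChange, Function.comp_apply, eq_intCast]

/-- **The integral classes of `Hᵏ(Y; ℂ)` form a countable set when `Hᵏ(Y; ℤ)` is finitely
generated**: they are the image of the countable group `Hᵏ(Y; ℤ)`
(`isIntegralClass_iff_mem_range_ringChange`). [cite: HatcherAT2002, §3.1 p. 198] -/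
theorem countable_setOf_isIntegralClass {Y : Type u} [TopologicalSpace Y] {k : ℕ}
    [Module.Finite ℤ (singularCohomology ℤ ℤ Y k)] :
    {c : singularCohomology ℂ ℂ Y k | IsIntegralClass c}.Countable := by
  haveI : Countable (singularCohomology ℤ ℤ Y k) := Finsupp.Countable.of_moduleFinite (R := ℤ)
  have h : {c : singularCohomology ℂ ℂ Y k | IsIntegralClass c} =
      Set.range (singularCohomology.ringChange (Int.castRingHom ℂ) Y k) :=
    Set.ext fun c ↦ isIntegralClass_iff_mem_range_ringChange c
  rw [h]
  exact Set.countable_range _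

/-- **For `X` smooth projective over `ℂ`, the integral classes of `Hᵏ(X(ℂ); ℂ)` form a countable
set** (`Hᵏ(X(ℂ); ℤ)` is finitely generated, `Motives.bettiCohomologyInt_finite_holds`: `X(ℂ)` is a
compact topological manifold) — the countability behind "the countable union of the `U_λ^{k-1}`
for integral `λ`" in the proof of Voisin II, Lemma 8.18.
[cite: HatcherAT2002, App. A Cor. A.8–A.9 and §3.1 p. 198] [cite: VoisinHodgeII2003, Lemma 8.18 (proof)] -/
theorem countable_setOf_isIntegralClass_complexPoints {n : ℕ} {X : Motives.SchemeOver ℂ}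
    (hX : Motives.IsSmoothProjective n X) (k : ℕ) :
    {c : singularCohomology ℂ ℂ (Motives.ComplexPoints X) k | IsIntegralClass c}.Countable := by
  haveI : Module.Finite ℤ (singularCohomology ℤ ℤ (Motives.ComplexPoints X) k) :=
    Motives.bettiCohomologyInt_finite_holds hX k
  exact countable_setOf_isIntegralClass

end HodgeTheory

end Literature.AlgebraicGeometry.HodgeTheory

end
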